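import Literature.Probability.RandomPlanarGeometry.DrivingProcessWeakLimit
import Literature.Probability.RandomPlanarGeometry.LoewnerCurveLimitDomain
import Literature.Probability.Process.PathSpaceTightness
import Literature.Probability.Process.PathSpaceCoupling
import HarnessLib

/-!
# Kemppainen–Smirnov's events: compact families of Loewner pairs, their curve classes, and the continuity of the Loewner transform on them

Topic `Literature/Probability/RandomPlanarGeometry` (family `crit-ising`); theorems only (no
definition, no named fact). Deterministic companion of `DrivingProcessWeakLimit.lean`.

Kemppainen–Smirnov prove their main theorem (Ann. Probab. 45 (2017), Thm. 1.5;
arXiv:1212.6215, Thm. 1.3) by producing, for every `ε > 0`, an event `E = ⋂ E_k` of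
probability `≥ 1 - ε` under every law of the family (§3.5) on which the curves, transported to
`ℍ` and parametrised by half-plane capacity, have (1) a common transience profile
(`E_1`, Prop. 3.2: "`N_0` is tight"), (2) equicontinuous driving terms (`E_3`, Thm. 3.9: the
Hölder norm `C_{2,α',T}` of the driving process is tight) and — through the equicontinuity of the
hyperbolic geodesics `F(t, y)` to the tip (`E_4`, Thm. 3.10, and the first paragraph of the proof
of Lemma A.5: "it is clearly enough to show that `(F_n)` is an equicontinuous family … on
`[0, T] × [0, 1]`") — (3) equicontinuous capacity parametrisations `γ̂ = F(·, 0)`; and then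
invoking the deterministic "main lemma with convergence" (App. A, Lemma A.5): on such an event,
limits of curves are Loewner curves driven by the limits of the driving terms. This file PROVES
that deterministic conclusion in the tree's vocabulary and in the form consumed by
`DrivingProcessWeakLimit.lean` (closed sets of describable curve classes on which the driving
path is continuous), for a FIXED Dobrushin domain `(D; a, b)` with chordal uniformizing map
`φ : ℍ → D` and boundary extension `Φ` (Carathéodory):

* `exists_forall_dist_nodeValue_le`, `continuousOn_compactifiedClass` — **the compactification
  `γ̂ ↦ ⟦Φ ∘ γ̂⟧` is (uniformly) continuous**, for the locally uniform topology, on every family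
  of curves in `ℍ̄` that is uniformly bounded on compacts of time and uniformly transient
  (`Φ` is uniformly continuous on compacts of `ℍ̄` and tends to `b` at infinity);
* `isLoewnerDescribed_compactifiedClass`, `drivingFunction_compactifiedClass` — the class of
  `Φ ∘ γ̂` for a Loewner pair `(γ̂, W)` (`generatedPairs`: the chain of `W` is generated by `γ̂`)
  with `γ̂` transient is described through `φ` by `W`, and its Loewner transform IS `W`
  (uniqueness of the driving function, `IsLoewnerDescribed.driving_unique_holds`);
* **`isClosed_image_and_continuousOn_drivingPath`** — for a COMPACT set `𝒦` of Loewner pairs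
  with a common transience profile, the set `E = {⟦Φ ∘ γ̂⟧ : (γ̂, W) ∈ 𝒦}` of curve classes is
  compact (hence closed), consists of describable classes, and the driving path
  `c ↦ W(c) ∈ C([0, ∞), ℝ)` is continuous on it (a closed-map argument: `E` is a continuous
  image of a compact set on which `W ∘ ⟦Φ ∘ ·⟧ = pr₂`) — KS Lemma A.5 "with convergence" in
  event form; the closedness of `generatedPairs` used on the way is Lawler–Schramm–Werner's
  Lemma 3.14 (`isClosed_generatedPairs`, `SLETraceApproximation.lean`);
* `isCompact_pairBox`, `isClosed_image_pairBox_and_continuousOn_drivingPath` — the compact sets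
  KS actually use: Loewner pairs with `γ̂ 0 = W 0 = 0`, prescribed moduli of continuity of `γ̂`
  and of `W` on every `[0, k+1]` (`Process.modulusSet`, compact by Arzelà–Ascoli,
  `Process.isCompact_modulusSet`) and a prescribed transience profile `‖γ̂ t‖ ≥ k` for
  `t ≥ T k`;
* **`ae_isLoewnerDescribable_and_tendstoInDistribution_drivingPath_of_pairBox`** — KS Thm. 1.5
  (ii)–(iii) for curve laws `μs n → ν` on `(D; a, b)`, GIVEN the tightness of the three moduli:
  if for every `ε > 0` some box has `μs n`-probability `≥ 1 - ε` for all `n`, then `ν`-a.e.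
  curve class is describable through `φ` and the driving processes converge in law to the
  driving function under `ν` (the (J′) clauses of
  `LatticeModels.isSLELaw_three_of_subseqLimit_spinInterface_of_limitData`).

What is NOT here (the probabilistic half of KS, §§3.2–3.4): that Condition G2 makes the three
moduli tight (Prop. 3.2 with Thm. 3.9, Thm. 3.10 and Lemma A.5's equicontinuity step).

## References

* A. Kemppainen, S. Smirnov, Ann. Probab. 45 (2017) 698–779: Thm. 1.5, §3.1 Prop. 3.2, §3.5,
  App. A Lemma A.5 (arXiv:1212.6215: Thm. 1.3, Prop. 3.2, §3.5 p. 18, Lemma 5.7 p. 32).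
  [KemppainenSmirnov2017]
* G. F. Lawler, O. Schramm, W. Werner, Ann. Probab. 32 (2004), Lemma 3.14. [LawlerSchrammWerner2004]
* Ch. Pommerenke, *Boundary Behaviour of Conformal Maps* (1992), Thm. 2.6 (Carathéodory).
  [PommerenkeBBCM1992]
-/

noncomputable section

open MeasureTheory Filter Topology Set Metric Bornology
open UpperHalfPlane (upperHalfPlaneSet)
open scoped NNReal ENNReal BoundedContinuousFunction unitInterval

namespace Literature.Probability.RandomPlanarGeometry

open scoped PathBorel

/-! ### Uniform continuity of the compactification on uniformly transient families -/

section Compactification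

variable {A : Set ℂ} {Φ : ℂ → ℂ} {b : ℂ}

/-- **Uniform estimate for compactified images.** Let `Φ` be continuous on a closed set `A` and
tend to `b` at infinity within `A`; let `𝒮` be a family of continuous paths in `A`, uniformly
bounded on every `[0, T]` and uniformly transient (`‖γ t‖ ≥ r` for `t ≥ T(r)`, all `γ ∈ 𝒮`).
Then for every `ε > 0` there are `T` and `η > 0` such that two paths of `𝒮` that are `η`-close
on `[0, T]` have compactified images (`nodeValue Φ b γ : [0, 1] → ℂ`, `s ↦ Φ (γ (s/(1-s)))`,
`1 ↦ b`) that are `ε`-close on all of `[0, 1]`. [folklore] -/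
theorem exists_forall_dist_nodeValue_le (hA : IsClosed A) (hΦ : ContinuousOn Φ A)
    (hΦinf : Tendsto Φ (cocompact ℂ ⊓ 𝓟 A) (𝓝 b)) {𝒮 : Set C(ℝ≥0, ℂ)}
    (h𝒮A : ∀ γ ∈ 𝒮, ∀ t, γ t ∈ A) (hbdd : ∀ T : ℝ≥0, ∃ R : ℝ, ∀ γ ∈ 𝒮, ∀ t ≤ T, ‖γ t‖ ≤ R)
    (htrans : ∀ r : ℝ, ∃ T : ℝ≥0, ∀ γ ∈ 𝒮, ∀ t, T ≤ t → r ≤ ‖γ t‖) {ε : ℝ} (hε : 0 < ε) :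
    ∃ (T : ℝ≥0) (η : ℝ), 0 < η ∧ ∀ γ ∈ 𝒮, ∀ γ' ∈ 𝒮,
      (∀ t : ℝ≥0, t ≤ T → dist (γ t) (γ' t) < η) →
        ∀ s : I, dist (nodeValue Φ b γ s) (nodeValue Φ b γ' s) ≤ ε := by
  -- far away, `Φ` is `ε/2`-close to `b`
  have hfar : ∃ r : ℝ, ∀ z ∈ A, r ≤ ‖z‖ → dist (Φ z) b < ε / 2 := by
    have h' : ∀ᶠ z in cocompact ℂ ⊓ 𝓟 A, dist (Φ z) b < ε / 2 :=
      Metric.tendsto_nhds.1 hΦinf (ε / 2) (half_pos hε)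
    rw [(hasBasis_cocompact.inf_principal _).eventually_iff] at h'
    obtain ⟨K, hK, hKε⟩ := h'
    obtain ⟨R, hR⟩ := hK.isBounded.subset_closedBall 0
    refine ⟨R + 1, fun z hzA hz ↦ hKε ⟨fun hzK ↦ ?_, hzA⟩⟩
    have := mem_closedBall_zero_iff.1 (hR hzK)
    linarith
  obtain ⟨r, hr⟩ := hfar
  obtain ⟨T, hT⟩ := htrans r
  obtain ⟨R, hR⟩ := hbdd T
  -- on the compact `A ∩ closedBall 0 R`, `Φ` is uniformly continuous
  have hcpt : IsCompact (A ∩ closedBall (0 : ℂ) R) :=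
    (isCompact_closedBall 0 R).inter_left hA
  have huc : UniformContinuousOn Φ (A ∩ closedBall (0 : ℂ) R) :=
    hcpt.uniformContinuousOn_of_continuous (hΦ.mono inter_subset_left)
  obtain ⟨η, hη, hηε⟩ := Metric.uniformContinuousOn_iff.1 huc ε hε
  refine ⟨T, η, hη, fun γ hγ γ' hγ' hclose s ↦ ?_⟩
  by_cases hs : (s : ℝ) < 1
  · rw [nodeValue_of_lt Φ b γ hs, nodeValue_of_lt Φ b γ' hs]
    set t : ℝ≥0 := rayParam s with ht
    by_cases htT : t ≤ T
    · -- near part: uniform continuity of `Φ`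
      have h1 : γ t ∈ A ∩ closedBall (0 : ℂ) R :=
        ⟨h𝒮A γ hγ t, mem_closedBall_zero_iff.2 (hR γ hγ t htT)⟩
      have h2 : γ' t ∈ A ∩ closedBall (0 : ℂ) R :=
        ⟨h𝒮A γ' hγ' t, mem_closedBall_zero_iff.2 (hR γ' hγ' t htT)⟩
      exact (hηε _ h1 _ h2 (hclose t htT)).le
    · -- far part: both values are `ε/2`-close to `b`
      have htT' : T ≤ t := (not_le.1 htT).le
      have h1 : dist (Φ (γ t)) b < ε / 2 := hr _ (h𝒮A γ hγ t) (hT γ hγ t htT')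
      have h2 : dist (Φ (γ' t)) b < ε / 2 := hr _ (h𝒮A γ' hγ' t) (hT γ' hγ' t htT')
      calc dist (Φ (γ t)) (Φ (γ' t)) ≤ dist (Φ (γ t)) b + dist (Φ (γ' t)) b :=
            dist_triangle_right _ _ _
        _ ≤ ε := by linarith
  · obtain rfl : s = 1 := Subtype.ext (le_antisymm s.2.2 (not_lt.1 hs))
    simp [hε.le]

/-- On a uniformly transient family every path tends to infinity. [folklore] -/
theorem tendsto_norm_atTop_of_transient {𝒮 : Set C(ℝ≥0, ℂ)}
    (htrans : ∀ r : ℝ, ∃ T : ℝ≥0, ∀ γ ∈ 𝒮, ∀ t, T ≤ t → r ≤ ‖γ t‖) {γ : C(ℝ≥0, ℂ)}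
    (hγ : γ ∈ 𝒮) : Tendsto (fun t ↦ ‖γ t‖) atTop atTop :=
  tendsto_atTop_atTop.2 fun r ↦ (htrans r).imp fun _ hT t ht ↦ hT γ hγ t ht

/-- The compactified image of a transient path in `A` is a continuous curve, so that
`compactifiedClass Φ b γ` is the class of `nodeValue Φ b γ`. [folklore] -/
theorem compactifiedClass_eq_mk_nodeValue (hΦ : ContinuousOn Φ A)
    (hΦinf : Tendsto Φ (cocompact ℂ ⊓ 𝓟 A) (𝓝 b)) {γ : C(ℝ≥0, ℂ)} (hγA : ∀ t, γ t ∈ A)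
    (hγinf : Tendsto (fun t ↦ ‖γ t‖) atTop atTop) :
    ∃ hc : Continuous (nodeValue Φ b γ),
      IsCompactifiedImage Φ γ b ⟨⟨nodeValue Φ b γ, hc⟩⟩ ∧
        compactifiedClass Φ b γ = CurveClass.mk ⟨⟨nodeValue Φ b γ, hc⟩⟩ := by
  have hc : Continuous (nodeValue Φ b γ) :=
    continuous_nodeValue hΦ hΦinf γ.continuous hγA (tendsto_cocompact_of_tendsto_norm_atTop hγinf)
  have hI : IsCompactifiedImage Φ γ b ⟨⟨nodeValue Φ b γ, hc⟩⟩ :=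
    ⟨fun s hs ↦ nodeValue_of_lt Φ b γ hs, nodeValue_one Φ b γ⟩
  exact ⟨hc, hI, hI.compactifiedClass_eq⟩

/-- **Continuity of the compactification `γ ↦ ⟦Φ ∘ γ⟧` on uniformly transient families** (for
the locally uniform topology on paths and the curve metric on classes): under the hypotheses of
`exists_forall_dist_nodeValue_le`, `γ ↦ compactifiedClass Φ b γ` is continuous on `𝒮` — two
`η`-close paths on `[0, T]` have `ε`-close classes (the curve distance is at most the sup
distance of parametrisations, `Curve.dist_le_dist_toContinuousMap`). [folklore] -/
theorem continuousOn_compactifiedClass (hA : IsClosed A) (hΦ : ContinuousOn Φ A)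
    (hΦinf : Tendsto Φ (cocompact ℂ ⊓ 𝓟 A) (𝓝 b)) {𝒮 : Set C(ℝ≥0, ℂ)}
    (h𝒮A : ∀ γ ∈ 𝒮, ∀ t, γ t ∈ A) (hbdd : ∀ T : ℝ≥0, ∃ R : ℝ, ∀ γ ∈ 𝒮, ∀ t ≤ T, ‖γ t‖ ≤ R)
    (htrans : ∀ r : ℝ, ∃ T : ℝ≥0, ∀ γ ∈ 𝒮, ∀ t, T ≤ t → r ≤ ‖γ t‖) :
    ContinuousOn (fun γ : C(ℝ≥0, ℂ) ↦ compactifiedClass Φ b γ) 𝒮 := by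
  intro γ₀ hγ₀
  rw [ContinuousWithinAt, Metric.tendsto_nhds]
  intro ε hε
  obtain ⟨T, η, hη, hest⟩ :=
    exists_forall_dist_nodeValue_le hA hΦ hΦinf h𝒮A hbdd htrans (half_pos hε)
  have hmem : 𝒮 ∩ Process.tube γ₀ T η ∈ 𝓝[𝒮] γ₀ :=
    inter_mem_nhdsWithin 𝒮 (Process.tube_mem_nhds γ₀ T hη)
  filter_upwards [hmem] with γ hγ
  obtain ⟨hγ𝒮, hγtube⟩ := hγ
  obtain ⟨hc, -, hγeq⟩ := compactifiedClass_eq_mk_nodeValue hΦ hΦinf (h𝒮A γ hγ𝒮)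
    (tendsto_norm_atTop_of_transient htrans hγ𝒮)
  obtain ⟨hc₀, -, hγ₀eq⟩ := compactifiedClass_eq_mk_nodeValue hΦ hΦinf (h𝒮A γ₀ hγ₀)
    (tendsto_norm_atTop_of_transient htrans hγ₀)
  rw [hγeq, hγ₀eq, CurveClass.dist_mk_mk]
  refine lt_of_le_of_lt ((Curve.dist_le_dist_toContinuousMap _ _).trans ?_) (half_lt_self hε)
  rw [ContinuousMap.dist_le (half_pos hε).le]
  intro s
  exact hest γ hγ𝒮 γ₀ hγ₀ (fun t ht ↦ Process.mem_tube.1 hγtube t ht) s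

end Compactification

/-! ### Loewner pairs: the class of `Φ ∘ γ̂` is described by `W` -/

section Pairs

variable {D : DobrushinDomain} {φ : ConformalEquiv upperHalfPlaneSet D.carrier}

/-- The boundary extension of a chordal uniformizing map is continuous on the closed
half-plane `{0 ≤ im}` (Carathéodory, `JordanDomain.continuousOn_boundaryExtension_holds`).
[cite: PommerenkeBBCM1992, Thm. 2.6] -/
theorem continuousOn_boundaryExtension_im_nonneg (φ : ConformalEquiv upperHalfPlaneSet D.carrier) :
    ContinuousOn φ.boundaryExtension {z : ℂ | 0 ≤ z.im} := by
  rw [← ConformalEquiv.closure_upperHalfPlaneSet_eq]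
  exact JordanDomain.continuousOn_boundaryExtension_holds D.toJordanDomain φ

/-- **A transient Loewner pair describes the class of its compactified image.** If the chain of
the continuous `W` is generated by `γ̂` (`(γ̂, W) ∈ generatedPairs`) and `‖γ̂ t‖ → ∞`, then the
class `⟦Φ ∘ γ̂⟧` (`compactifiedClass`) is described through `φ` by `W`
(`IsLoewnerDescribed`). [cite: KemppainenSmirnov2017, §1.2] -/
theorem isLoewnerDescribed_compactifiedClass (hφ : D.IsChordalUniformizing φ)
    {p : C(ℝ≥0, ℂ) × C(ℝ≥0, ℝ)} (hp : p ∈ generatedPairs)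
    (htr : Tendsto (fun t ↦ ‖p.1 t‖) atTop atTop) :
    IsLoewnerDescribed φ (compactifiedClass φ.boundaryExtension (D.pt 1) p.1) p.2 := by
  have hA : ∀ t, p.1 t ∈ {z : ℂ | 0 ≤ z.im} := fun t ↦ hp.2.2.1 t
  obtain ⟨hc, hI, heq⟩ := compactifiedClass_eq_mk_nodeValue
    (continuousOn_boundaryExtension_im_nonneg φ)
    (MarkedDomain.IsChordalUniformizing.tendsto_boundaryExtension_cocompact hφ) hA htr
  exact ⟨p.2.continuous, p.1, hp, _, heq, hI⟩

/-- **The Loewner transform of `⟦Φ ∘ γ̂⟧` is `W`** for a transient Loewner pair `(γ̂, W)`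
(uniqueness of the driving function, `IsLoewnerDescribed.driving_unique_holds`).
[cite: KemppainenSmirnov2017, §1.2] -/
theorem drivingFunction_compactifiedClass (hφ : D.IsChordalUniformizing φ)
    {p : C(ℝ≥0, ℂ) × C(ℝ≥0, ℝ)} (hp : p ∈ generatedPairs)
    (htr : Tendsto (fun t ↦ ‖p.1 t‖) atTop atTop) :
    drivingFunction φ (compactifiedClass φ.boundaryExtension (D.pt 1) p.1) = p.2 :=
  IsLoewnerDescribed.drivingFunction_eq IsLoewnerDescribed.driving_unique_holds hφ
    (isLoewnerDescribed_compactifiedClass hφ hp htr)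

/-- The driving PATH of `⟦Φ ∘ γ̂⟧` is `W` (bundled form of `drivingFunction_compactifiedClass`).
[cite: KemppainenSmirnov2017, §1.2] -/
theorem drivingPath_compactifiedClass (hφ : D.IsChordalUniformizing φ)
    {p : C(ℝ≥0, ℂ) × C(ℝ≥0, ℝ)} (hp : p ∈ generatedPairs)
    (htr : Tendsto (fun t ↦ ‖p.1 t‖) atTop atTop) :
    (⟨drivingFunction φ (compactifiedClass φ.boundaryExtension (D.pt 1) p.1),
      continuous_drivingFunction φ _⟩ : C(ℝ≥0, ℝ)) = p.2 :=
  ContinuousMap.ext fun t ↦ by rw [ContinuousMap.coe_mk, drivingFunction_compactifiedClass hφ hp htr]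

/-! ### Compact families of Loewner pairs: Kemppainen–Smirnov's events -/

/-- **Kemppainen–Smirnov's Lemma A.5 in event form.** Let `𝒦` be a COMPACT set of Loewner
pairs `(γ̂, W)` (locally uniform topologies; `(γ̂, W) ∈ generatedPairs`) with a common transience
profile (`‖γ̂ t‖ ≥ r` for `t ≥ T(r)`). Then, for a chordal uniformizing map `φ` of `(D; a, b)`
with boundary extension `Φ`: the compactification `(γ̂, W) ↦ ⟦Φ ∘ γ̂⟧` is continuous on `𝒦`;
the set `E = {⟦Φ ∘ γ̂⟧ : (γ̂, W) ∈ 𝒦}` of curve classes is compact, hence closed; every class in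
`E` is describable through `φ` (`IsLoewnerDescribable`); and the driving path
`c ↦ W(c) = drivingFunction φ c ∈ C([0, ∞), ℝ)` is continuous on `E`. (KS, proof of Thm. 1.5,
§3.5: on `E = ⋂ E_k` "the rest of the claims follow from Lemma A.5"; the identification of the
limit chain uses Lawler–Schramm–Werner's Lemma 3.14, `isClosed_generatedPairs`.)
[cite: KemppainenSmirnov2017, §3.5 and App. A Lemma A.5] -/
theorem isClosed_image_and_continuousOn_drivingPath (hφ : D.IsChordalUniformizing φ)
    {𝒦 : Set (C(ℝ≥0, ℂ) × C(ℝ≥0, ℝ))} (h𝒦 : IsCompact 𝒦) (hgen : 𝒦 ⊆ generatedPairs)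
    (htrans : ∀ r : ℝ, ∃ T : ℝ≥0, ∀ p ∈ 𝒦, ∀ t, T ≤ t → r ≤ ‖p.1 t‖) :
    ContinuousOn (fun p ↦ compactifiedClass φ.boundaryExtension (D.pt 1) p.1) 𝒦 ∧
    IsCompact ((fun p ↦ compactifiedClass φ.boundaryExtension (D.pt 1) p.1) '' 𝒦) ∧
    IsClosed ((fun p ↦ compactifiedClass φ.boundaryExtension (D.pt 1) p.1) '' 𝒦) ∧
    (∀ c ∈ (fun p ↦ compactifiedClass φ.boundaryExtension (D.pt 1) p.1) '' 𝒦,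
      IsLoewnerDescribable φ c) ∧
    ContinuousOn (fun c ↦ (⟨drivingFunction φ c, continuous_drivingFunction φ c⟩ : C(ℝ≥0, ℝ)))
      ((fun p ↦ compactifiedClass φ.boundaryExtension (D.pt 1) p.1) '' 𝒦) := by
  set Φ : ℂ → ℂ := φ.boundaryExtension with hΦdef
  set b : ℂ := D.pt 1 with hbdef
  set cls : C(ℝ≥0, ℂ) × C(ℝ≥0, ℝ) → CurveClass ℂ := fun p ↦ compactifiedClass Φ b p.1 with hcls
  have hA : IsClosed {z : ℂ | 0 ≤ z.im} := isClosed_le continuous_const Complex.continuous_im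
  have hΦc : ContinuousOn Φ {z : ℂ | 0 ≤ z.im} := continuousOn_boundaryExtension_im_nonneg φ
  have hΦinf : Tendsto Φ (cocompact ℂ ⊓ 𝓟 {z : ℂ | 0 ≤ z.im}) (𝓝 b) :=
    MarkedDomain.IsChordalUniformizing.tendsto_boundaryExtension_cocompact hφ
  -- the family of first coordinates
  set 𝒮 : Set C(ℝ≥0, ℂ) := Prod.fst '' 𝒦 with h𝒮
  have h𝒮A : ∀ γ ∈ 𝒮, ∀ t, γ t ∈ {z : ℂ | 0 ≤ z.im} := by
    rintro γ ⟨p, hp, rfl⟩ t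
    exact (hgen hp).2.2.1 t
  have htrans𝒮 : ∀ r : ℝ, ∃ T : ℝ≥0, ∀ γ ∈ 𝒮, ∀ t, T ≤ t → r ≤ ‖γ t‖ := by
    intro r
    obtain ⟨T, hT⟩ := htrans r
    refine ⟨T, ?_⟩
    rintro γ ⟨p, hp, rfl⟩ t ht
    exact hT p hp t ht
  -- uniform boundedness on compacts of time, from compactness of `𝒦`
  have hbdd : ∀ T : ℝ≥0, ∃ R : ℝ, ∀ γ ∈ 𝒮, ∀ t ≤ T, ‖γ t‖ ≤ R := by
    intro T
    have hev : Continuous fun q : (C(ℝ≥0, ℂ) × C(ℝ≥0, ℝ)) × ℝ≥0 ↦ q.1.1 q.2 :=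
      (continuous_fst.comp continuous_fst).eval continuous_snd
    have hcpt : IsCompact ((fun q : (C(ℝ≥0, ℂ) × C(ℝ≥0, ℝ)) × ℝ≥0 ↦ q.1.1 q.2) '' 𝒦 ×ˢ Icc 0 T) :=
      (h𝒦.prod isCompact_Icc).image hev
    obtain ⟨R, hR⟩ := hcpt.isBounded.subset_closedBall 0
    refine ⟨R, ?_⟩
    rintro γ ⟨p, hp, rfl⟩ t ht
    exact mem_closedBall_zero_iff.1 (hR ⟨(p, t), ⟨hp, ⟨zero_le, ht⟩⟩, rfl⟩)
  -- continuity of `cls` on `𝒦`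
  have hclsc : ContinuousOn cls 𝒦 := by
    have h1 : ContinuousOn (fun γ : C(ℝ≥0, ℂ) ↦ compactifiedClass Φ b γ) 𝒮 :=
      continuousOn_compactifiedClass hA hΦc hΦinf h𝒮A hbdd htrans𝒮
    exact h1.comp continuous_fst.continuousOn fun p hp ↦ ⟨p, hp, rfl⟩
  have hEcpt : IsCompact (cls '' 𝒦) := h𝒦.image_of_continuousOn hclsc
  have htrp : ∀ p ∈ 𝒦, Tendsto (fun t ↦ ‖p.1 t‖) atTop atTop := fun p hp ↦
    tendsto_norm_atTop_of_transient htrans𝒮 ⟨p, hp, rfl⟩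
  refine ⟨hclsc, hEcpt, hEcpt.isClosed, ?_, ?_⟩
  · rintro c ⟨p, hp, rfl⟩
    exact ⟨p.2, isLoewnerDescribed_compactifiedClass hφ (hgen hp) (htrp p hp)⟩
  · -- continuity of the driving path on `E` by the closed-map argument
    rw [continuousOn_iff_isClosed]
    intro C hC
    refine ⟨cls '' (𝒦 ∩ {p | p.2 ∈ C}), ?_, ?_⟩
    · exact ((h𝒦.inter_right (hC.preimage continuous_snd)).image_of_continuousOn
        (hclsc.mono inter_subset_left)).isClosed
    · ext c
      constructor
      · rintro ⟨hcC, p, hp, rfl⟩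
        refine ⟨⟨p, ⟨hp, ?_⟩, rfl⟩, p, hp, rfl⟩
        have : (⟨drivingFunction φ (cls p), continuous_drivingFunction φ _⟩ : C(ℝ≥0, ℝ)) = p.2 :=
          drivingPath_compactifiedClass hφ (hgen hp) (htrp p hp)
        simpa [this] using hcC
      · rintro ⟨⟨p, ⟨hp, hpC⟩, rfl⟩, -⟩
        refine ⟨?_, p, hp, rfl⟩
        show (⟨drivingFunction φ (cls p), continuous_drivingFunction φ _⟩ : C(ℝ≥0, ℝ)) ∈ C
        rw [drivingPath_compactifiedClass hφ (hgen hp) (htrp p hp)]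
        exact hpC

/-! ### The boxes: prescribed moduli of `γ̂` and `W` and a prescribed transience profile -/

/-- **Compactness of the Kemppainen–Smirnov boxes.** The set of Loewner pairs `(γ̂, W)` with
`γ̂ 0 = 0`, `W 0 = 0`, moduli of continuity `δγ`, `δW` on every `[0, k+1]`
(`Process.modulusSet {0}`), and transience profile `‖γ̂ t‖ ≥ k` for `t ≥ T k`, is compact in
`C([0, ∞), ℂ) × C([0, ∞), ℝ)`: closed (`isClosed_generatedPairs` — LSW Lemma 3.14 —, closed
moduli and transience constraints) inside the product of two Arzelà–Ascoli compacts
(`Process.isCompact_modulusSet`). [cite: KemppainenSmirnov2017, §3.5] -/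
theorem isCompact_pairBox {δγ δW : ℕ → ℝ} (hδγ : ∀ k, 0 < δγ k) (hδW : ∀ k, 0 < δW k)
    (T : ℕ → ℝ≥0) :
    IsCompact {p : C(ℝ≥0, ℂ) × C(ℝ≥0, ℝ) | p ∈ generatedPairs ∧
      p.1 ∈ Process.modulusSet ({0} : Set ℂ) δγ ∧ p.2 ∈ Process.modulusSet ({0} : Set ℝ) δW ∧
      ∀ (k : ℕ) (t : ℝ≥0), T k ≤ t → (k : ℝ) ≤ ‖p.1 t‖} := by
  have hprod : IsCompact ((Process.modulusSet ({0} : Set ℂ) δγ) ×ˢ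
      (Process.modulusSet ({0} : Set ℝ) δW)) :=
    (Process.isCompact_modulusSet isCompact_singleton hδγ).prod
      (Process.isCompact_modulusSet isCompact_singleton hδW)
  have htr : IsClosed {p : C(ℝ≥0, ℂ) × C(ℝ≥0, ℝ) |
      ∀ (k : ℕ) (t : ℝ≥0), T k ≤ t → (k : ℝ) ≤ ‖p.1 t‖} := by
    have : {p : C(ℝ≥0, ℂ) × C(ℝ≥0, ℝ) | ∀ (k : ℕ) (t : ℝ≥0), T k ≤ t → (k : ℝ) ≤ ‖p.1 t‖} =
        ⋂ (k : ℕ) (t : ℝ≥0) (_ : T k ≤ t), {p | (k : ℝ) ≤ ‖p.1 t‖} := by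
      ext p; simp only [mem_setOf_eq, mem_iInter]
    rw [this]
    refine isClosed_iInter fun k ↦ isClosed_iInter fun t ↦ isClosed_iInter fun _ ↦ ?_
    exact isClosed_le continuous_const
      ((continuous_eval_const t).comp continuous_fst).norm
  refine hprod.of_isClosed_subset (isClosed_generatedPairs.inter
    (((Process.isClosed_modulusSet isClosed_singleton δγ).preimage continuous_fst).inter
      (((Process.isClosed_modulusSet isClosed_singleton δW).preimage continuous_snd).inter htr)))
    ?_
  rintro p ⟨-, h1, h2, -⟩
  exact ⟨h1, h2⟩

/-- **Kemppainen–Smirnov's events as closed sets of describable curve classes on which the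
Loewner transform is continuous**: the image `E` of a box (`isCompact_pairBox`) under
`(γ̂, W) ↦ ⟦Φ ∘ γ̂⟧` is closed, made of classes describable through `φ`, and `c ↦ W(c)` is
continuous on it — the hypotheses of `ae_isLoewnerDescribable_and_tendstoInDistribution_drivingPath`
(`DrivingProcessWeakLimit.lean`). [cite: KemppainenSmirnov2017, §3.5 and App. A Lemma A.5] -/
theorem isClosed_image_pairBox_and_continuousOn_drivingPath (hφ : D.IsChordalUniformizing φ)
    {δγ δW : ℕ → ℝ} (hδγ : ∀ k, 0 < δγ k) (hδW : ∀ k, 0 < δW k) (T : ℕ → ℝ≥0) :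
    let 𝒦 : Set (C(ℝ≥0, ℂ) × C(ℝ≥0, ℝ)) := {p | p ∈ generatedPairs ∧
      p.1 ∈ Process.modulusSet ({0} : Set ℂ) δγ ∧ p.2 ∈ Process.modulusSet ({0} : Set ℝ) δW ∧
      ∀ (k : ℕ) (t : ℝ≥0), T k ≤ t → (k : ℝ) ≤ ‖p.1 t‖}
    IsClosed ((fun p ↦ compactifiedClass φ.boundaryExtension (D.pt 1) p.1) '' 𝒦) ∧
    (∀ c ∈ (fun p ↦ compactifiedClass φ.boundaryExtension (D.pt 1) p.1) '' 𝒦,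
      IsLoewnerDescribable φ c) ∧
    ContinuousOn (fun c ↦ (⟨drivingFunction φ c, continuous_drivingFunction φ c⟩ : C(ℝ≥0, ℝ)))
      ((fun p ↦ compactifiedClass φ.boundaryExtension (D.pt 1) p.1) '' 𝒦) := by
  intro 𝒦
  have htrans : ∀ r : ℝ, ∃ T' : ℝ≥0, ∀ p ∈ 𝒦, ∀ t, T' ≤ t → r ≤ ‖p.1 t‖ := by
    intro r
    refine ⟨T ⌈r⌉₊, fun p hp t ht ↦ (Nat.le_ceil r).trans (hp.2.2.2 _ t ht)⟩
  obtain ⟨-, -, h3, h4, h5⟩ := isClosed_image_and_continuousOn_drivingPath hφ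
    (isCompact_pairBox hδγ hδW T) (fun p hp ↦ hp.1) htrans
  exact ⟨h3, h4, h5⟩

/-! ### Kemppainen–Smirnov's Theorem 1.5 (ii)–(iii) given the tightness of the moduli -/

/-- **Kemppainen–Smirnov's Thm. 1.5 (ii)–(iii) for curve laws on a Dobrushin domain, given the
tightness of the three moduli.** Let `φ` be a chordal uniformizing map of `(D; a, b)` and let
probability laws `μs n` on curve classes converge weakly to `ν`. Suppose that for every `ε > 0`
there are moduli `δγ, δW > 0` and a transience profile `T` such that, for ALL `n`, with
`μs n`-probability at least `1 - ε` the curve class is `⟦Φ ∘ γ̂⟧` for a Loewner pair `(γ̂, W)`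
(the capacity parametrisation of its pull-back to `ℍ` and its driving term) lying in the box —
`γ̂ 0 = W 0 = 0`, moduli `δγ`/`δW` on every `[0, k+1]`, `‖γ̂ t‖ ≥ k` for `t ≥ T k` — (KS
Prop. 3.2: tightness of `N_0`, `C_{2,α',T}`, and of the modulus of `γ̂` via `C_{3,ψ,T,R}` and
Lemma A.5). Then `ν`-a.e. curve class is described by the Loewner evolution through `φ`, and the
driving processes `V n u c = drivingFunction φ c u` on `(CurveClass ℂ, μs n)` converge in
distribution on `C([0, ∞), ℝ)` to the driving function under `ν` — the clauses `hdesc`, `hlaw`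
of `LatticeModels.isSLELaw_three_of_subseqLimit_spinInterface_of_limitData`. PROVED.
[cite: KemppainenSmirnov2017, Thm. 1.5 (ii)–(iii), Prop. 3.2, §3.5] -/
theorem ae_isLoewnerDescribable_and_tendstoInDistribution_drivingPath_of_pairBox
    (hφ : D.IsChordalUniformizing φ) {μs : ℕ → Measure (CurveClass ℂ)}
    [∀ n, IsProbabilityMeasure (μs n)] {ν : Measure (CurveClass ℂ)} [IsProbabilityMeasure ν]
    (hlim : ∀ f : CurveClass ℂ →ᵇ ℝ, Tendsto (fun n ↦ ∫ c, f c ∂μs n) atTop (𝓝 (∫ c, f c ∂ν)))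
    (h : ∀ ε : ℝ≥0∞, 0 < ε → ∃ (δγ δW : ℕ → ℝ) (T : ℕ → ℝ≥0), (∀ k, 0 < δγ k) ∧ (∀ k, 0 < δW k) ∧
      ∀ n, μs n ((fun p ↦ compactifiedClass φ.boundaryExtension (D.pt 1) p.1) ''
        {p : C(ℝ≥0, ℂ) × C(ℝ≥0, ℝ) | p ∈ generatedPairs ∧
          p.1 ∈ Process.modulusSet ({0} : Set ℂ) δγ ∧ p.2 ∈ Process.modulusSet ({0} : Set ℝ) δW ∧
          ∀ (k : ℕ) (t : ℝ≥0), T k ≤ t → (k : ℝ) ≤ ‖p.1 t‖})ᶜ ≤ ε) :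
    (∀ᵐ c ∂ν, IsLoewnerDescribable φ c) ∧
      TendstoInDistribution
        (fun (_ : ℕ) (c : CurveClass ℂ) ↦
          (⟨fun u ↦ drivingFunction φ c u, continuous_drivingFunction φ c⟩ : C(ℝ≥0, ℝ)))
        atTop (fun c ↦ (⟨drivingFunction φ c, continuous_drivingFunction φ c⟩ : C(ℝ≥0, ℝ))) μs ν := by
  refine ae_isLoewnerDescribable_and_tendstoInDistribution_drivingPath hφ hlim fun ε hε ↦ ?_
  obtain ⟨δγ, δW, T, hδγ, hδW, hall⟩ := h ε hε
  obtain ⟨h1, h2, h3⟩ := isClosed_image_pairBox_and_continuousOn_drivingPath hφ hδγ hδW T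
  exact ⟨_, h1, h2, h3, hall⟩

end Pairs

end Literature.Probability.RandomPlanarGeometry
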